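import Mathlib
import Summits.PneNP.PneNP.Theses.OneSlice
import Summits.PneNP.PneNP.Theorems.OneSliceSliceTargetSplit
import Summits.PneNP.PneNP.Theorems.OneSliceSliceTargetSplitStability
import Summits.PneNP.PneNP.Theorems.OneSliceMonotoneContinuationDefs
import Summits.PneNP.PneNP.Theorems.OneSliceMonotoneContinuationSamplerBounds
import Summits.PneNP.PneNP.Theorems.OneSliceMonotoneContinuationNearBoolean
import Summits.PneNP.PneNP.Theorems.OneSliceMonotoneContinuationShellMass
import Summits.PneNP.PneNP.Theorems.OneSliceMonotoneContinuationPadVotes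
import Summits.PneNP.PneNP.Theorems.OneSliceMonotoneContinuationBridgeWindow

/-!
# Route OneSlice, crux `MonotoneContinuation` (stmt-PneNP-18471), line `Sketch_ideator1_r1` — bridge `MC → flat-above`,
part 4: near-Booleanness below the upper shell, the two-slice test measure, and one slice of the bridge

`nb_bound`: if `𝟙[F]` is `ε`-close to `ĝ` in `L¹(G(n,p))` and the levels above `s` carry binomial mass `≥ c₀`, then
`Σ_{slice s} ĝ(1-ĝ) ≤ #slice_s · ε/c₀` (`nearBoolean_mono_above`).  `bridge_sliceError`: on a slice `i ∈ [j, j + Lq + 1]`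
the padded votes of `f'` are within `#slice_i · (2/c_b ‖𝟙[f'] - ĝ‖₁ + 10 ε/c₀ + (7/2)(20 m/N))` of the reference
(`padVote_error` + `bridge_window` + `shellMass_pointwise`).  `nuTwo`-lemmas: the two-slice test measure.
-/

set_option linter.dupNamespace false -- `Summit.PneNP.PneNP.…`: summit = sub-problem (D-0017)

namespace Summit.PneNP.PneNP.Theorems.MonotoneContinuation

open Literature.Computability.Complexity hiding supp mem_supp
open Finset hiding slice
open Filter hiding mem_sdiff
open Classical
open Summit.PneNP.PneNP.Theorems (card_slice binomialWeight_tail_le binomialWeight_nonneg)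
open Summit.PneNP.PneNP.Theorems.ConstantBand.Negative (Edge thr Central slice)
open Summit.PneNP.PneNP.Theorems.SingleThreshold.Negative (pc tendsto_pc)
open Summit.PneNP.PneNP.Theorems.SliceACZero.Negative (supp mem_supp card_supp)
open Summit.PneNP.PneNP.Theorems.SliceTargetSplit (nbhd mem_nbhd transport ind l1 card_nbhd_of_le comp_iff_supp
  transport_ind_mem ind_nonneg ind_le_one l1_triangle l1_nonneg transport_nonneg rdist_eq_l1)

noncomputable section

variable {n : ℕ}

/-! ## Part 3b — near-Booleanness below the upper shell, and the two-slice test measure -/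

/-- **Near-Booleanness is cheap below the upper shell.** If `𝟙[F]` is `ε`-close to `ĝ = T_j 𝟙[g₀]` in `L¹(G(n,p))` and the
levels `U` above `s` carry binomial mass `≥ c₀`, then `Σ_{slice s} ĝ(1-ĝ) ≤ #slice_s · ε/c₀` (pointwise `ĝ(1-ĝ) ≤ |𝟙[F]-ĝ|`,
and the level averages of `ĝ(1-ĝ)` do not decrease going up, `nearBoolean_mono_above`). -/
theorem nb_bound {p : ℝ} (hp0 : 0 ≤ p) (hp1 : p ≤ 1) {j s : ℕ} (hjs : j ≤ s) (g₀ F : (Edge n → Bool) → Bool)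
    {ε c₀ : ℝ} (hc₀ : 0 < c₀) (hF : l1 n p (ind F) (transport j (ind g₀)) ≤ ε)
    (U : Finset ℕ) (hU : ∀ u ∈ U, s ≤ u ∧ u ≤ n.choose 2) (hUmass : c₀ ≤ ∑ u ∈ U, binW (n.choose 2) p u) :
    ∑ y ∈ slice n s, transport j (ind g₀) y * (1 - transport j (ind g₀) y) ≤ #(slice n s) * (ε / c₀) := by
  set N := n.choose 2 with hN
  set T := transport j (ind g₀) with hTdef
  set nb : ℕ → ℝ := fun u => (∑ y ∈ slice n u, T y * (1 - T y)) / #(slice n u) with hnb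
  have hUne : U.Nonempty := by
    by_contra h
    rw [not_nonempty_iff_eq_empty] at h
    rw [h, sum_empty] at hUmass
    linarith
  obtain ⟨u₀, hu₀⟩ := hUne
  have hsN : s ≤ N := (hU u₀ hu₀).1.trans (hU u₀ hu₀).2
  have hspos : (0 : ℝ) < #(slice n s) := by exact_mod_cast card_slice_pos hsN
  -- `Σ_u binW(u) nb(u) ≤ l1 ≤ ε` over the whole cube
  have htot : ∑ u ∈ range (N + 1), binW N p u * nb u ≤ ε := by
    refine le_trans ?_ hF
    rw [votes_l1_eq]
    refine sum_le_sum fun u hu => ?_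
    have huN : u ≤ N := Nat.lt_succ_iff.1 (mem_range.1 hu)
    have hpos : (0 : ℝ) < #(slice n u) := by exact_mod_cast card_slice_pos huN
    refine mul_le_mul_of_nonneg_left ?_ (binW_nonneg hp0 hp1 u)
    simp only [hnb]
    refine div_le_div_of_nonneg_right (sum_le_sum fun y _ => ?_) hpos.le
    have h := votes_mul_one_sub_le_abs (transport_ind_mem (j := j) g₀ y).1 (transport_ind_mem (j := j) g₀ y).2 (F y)
    simpa only [ind] using h
  -- restrict to `U` and use monotonicity `nb s ≤ nb u`
  have hmono : ∀ u ∈ U, nb s ≤ nb u := fun u hu =>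
    nearBoolean_mono_above n j s u g₀ hjs (hU u hu).1 (hU u hu).2
  have hUsum : (∑ u ∈ U, binW N p u) * nb s ≤ ∑ u ∈ range (N + 1), binW N p u * nb u := by
    calc (∑ u ∈ U, binW N p u) * nb s = ∑ u ∈ U, binW N p u * nb s := by rw [sum_mul]
      _ ≤ ∑ u ∈ U, binW N p u * nb u :=
          sum_le_sum fun u hu => mul_le_mul_of_nonneg_left (hmono u hu) (binW_nonneg hp0 hp1 u)
      _ ≤ ∑ u ∈ range (N + 1), binW N p u * nb u := by
          refine sum_le_sum_of_subset_of_nonneg (fun u hu => ?_) (fun u _ _ => mul_nonneg (binW_nonneg hp0 hp1 u) ?_)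
          · rw [mem_range]; exact Nat.lt_succ_of_le (hU u hu).2
          · exact div_nonneg (sum_nonneg fun y _ => mul_nonneg (transport_ind_mem (j := j) g₀ y).1
              (by linarith [(transport_ind_mem (j := j) g₀ y).2])) (Nat.cast_nonneg _)
  have hnbs0 : 0 ≤ nb s := div_nonneg (sum_nonneg fun y _ => mul_nonneg (transport_ind_mem (j := j) g₀ y).1
    (by linarith [(transport_ind_mem (j := j) g₀ y).2])) (Nat.cast_nonneg _)
  have hkey : c₀ * nb s ≤ ε := by
    calc c₀ * nb s ≤ (∑ u ∈ U, binW N p u) * nb s := mul_le_mul_of_nonneg_right hUmass hnbs0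
      _ ≤ ε := hUsum.trans htot
  have hnbs : nb s ≤ ε / c₀ := by rw [le_div_iff₀ hc₀, mul_comm]; exact hkey
  have : ∑ y ∈ slice n s, T y * (1 - T y) = #(slice n s) * nb s := by
    simp only [hnb]; rw [mul_div_cancel₀ _ hspos.ne']
  rw [this]
  exact mul_le_mul_of_nonneg_left hnbs hspos.le

/-- The test measure is nonnegative. -/
theorem nuTwo_nonneg (j i : ℕ) (y : Edge n → Bool) : 0 ≤ nuTwo n j i y := by
  unfold nuTwo; positivity

/-- Integrating against the test measure. -/
theorem sum_nuTwo_mul (j i : ℕ) (h : (Edge n → Bool) → ℝ) :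
    ∑ y, nuTwo n j i y * h y = (∑ y ∈ slice n j, h y) / (2 * #(slice n j)) + (∑ y ∈ slice n i, h y) / (2 * #(slice n i)) := by
  unfold nuTwo
  simp_rw [add_mul]
  rw [sum_add_distrib]
  congr 1
  · rw [padLanding_sum_slice, sum_div]
    exact sum_congr rfl fun y _ => by split_ifs <;> ring
  · rw [padLanding_sum_slice, sum_div]
    exact sum_congr rfl fun y _ => by split_ifs <;> ring

/-- The test measure is a probability vector (both slices inside the cube). -/
theorem nuTwo_sum {j i : ℕ} (hj : j ≤ n.choose 2) (hi : i ≤ n.choose 2) : ∑ y, nuTwo n j i y = 1 := by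
  have h := sum_nuTwo_mul (n := n) j i (fun _ => 1)
  simp_rw [mul_one] at h
  rw [h, sum_const, sum_const, nsmul_eq_mul, nsmul_eq_mul, mul_one, mul_one]
  have h1 : (0 : ℝ) < #(slice n j) := by exact_mod_cast card_slice_pos hj
  have h2 : (0 : ℝ) < #(slice n i) := by exact_mod_cast card_slice_pos hi
  field_simp
  ring

/-- Reading one slice off a test-measure bound: `Σ_{slice j} h ≤ 2 #slice_j · B` whenever `Σ_y ν(y) h(y) ≤ B`, `h ≥ 0`. -/
theorem slice_le_of_nuTwo_le {j i : ℕ} (hj : j ≤ n.choose 2) {h : (Edge n → Bool) → ℝ} (hh : ∀ y, 0 ≤ h y) {B : ℝ}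
    (hB : ∑ y, nuTwo n j i y * h y ≤ B) :
    ∑ y ∈ slice n j, h y ≤ #(slice n j) * (2 * B) ∧ ∑ y ∈ slice n i, h y ≤ #(slice n i) * (2 * B) := by
  rw [sum_nuTwo_mul] at hB
  have h1 : (0 : ℝ) < #(slice n j) := by exact_mod_cast card_slice_pos hj
  have hA : 0 ≤ (∑ y ∈ slice n j, h y) / (2 * #(slice n j)) := div_nonneg (sum_nonneg fun y _ => hh y) (by positivity)
  have hBi : 0 ≤ (∑ y ∈ slice n i, h y) / (2 * #(slice n i)) := div_nonneg (sum_nonneg fun y _ => hh y) (by positivity)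
  constructor
  · have : (∑ y ∈ slice n j, h y) / (2 * #(slice n j)) ≤ B := by linarith
    rw [div_le_iff₀ (by positivity)] at this
    linarith
  · rcases Nat.eq_zero_or_pos #(slice n i) with h0 | hpos
    · have hemp : slice n i = ∅ := card_eq_zero.1 h0
      rw [hemp, sum_empty, card_empty]; simp
    · have h2 : (0 : ℝ) < #(slice n i) := by exact_mod_cast hpos
      have : (∑ y ∈ slice n i, h y) / (2 * #(slice n i)) ≤ B := by linarith
      rw [div_le_iff₀ (by positivity)] at this
      linarith


/-! ## Part 3c — one slice of the bridge: the padded votes are accurate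

Fix the base slice `j ≤ m`, a slice `i ∈ [j, j + Lq + 1]` (`q = ⌊√m⌋`), the size window `A = [a₀, a₀ + q]` and the
reference `Gref` on slice `i` (the slice function on `j`, the rounded transport above).  The slice-`i` sum of
`|E_ρ 𝟙[f'(x ∨ ρ)] - Gref(x)|` is at most `#slice_i · E₀` with
`E₀ = (2/c_b) ‖𝟙[f'] - ĝ‖₁ + 10 ε/c₀ + (7/2)(20 m/N)`.
-/

/-- `cbConst L > 0`. -/
theorem cbConst_pos (L : ℕ) : 0 < cbConst L := by unfold cbConst; positivity

/-- Membership in the size window. -/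
theorem mem_padWindow {N m j a : ℕ} :
    a ∈ padWindow N m j ↔ padBase N m (Nat.sqrt m) j ≤ a ∧ a ≤ padBase N m (Nat.sqrt m) j + Nat.sqrt m := by
  rw [padWindow, Finset.mem_Ico]; omega

/-- The size window has `q + 1` elements and is nonempty. -/
theorem card_padWindow (N m j : ℕ) : #(padWindow N m j) = Nat.sqrt m + 1 := by
  rw [padWindow, Nat.card_Ico]; omega

/-- **One slice of the bridge.** -/
theorem bridge_sliceError {p : ℝ} (hp0 : 0 < p) (hp2 : p ≤ 1 / 2) {m L j i : ℕ}
    (hmμ : (m : ℝ) ≤ ((n.choose 2 : ℕ) : ℝ) * p) (hμm : ((n.choose 2 : ℕ) : ℝ) * p < m + 1)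
    (hq : L + 8 ≤ Nat.sqrt m) (hsm : 40 * (((L : ℝ) + 6) / 2) ≤ Real.sqrt m)
    (hN : 8 * (L + 2) * m ≤ n.choose 2) (hjm : j ≤ m) (hji : j ≤ i) (hij : i ≤ j + L * Nat.sqrt m + 1)
    (f' g₀ F : (Edge n → Bool) → Bool) (Gref : (Edge n → Bool) → ℝ) {ε ηMC c₀ : ℝ} (hc₀ : 0 < c₀)
    (hF : l1 n p (ind F) (transport j (ind g₀)) ≤ ε) (hclose : l1 n p (ind f') (transport j (ind g₀)) ≤ ηMC)
    (hU : c₀ ≤ ∑ u ∈ (range (n.choose 2 + 1)).filter (fun u : ℕ =>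
        (m : ℝ) + ((L + 6 : ℕ) : ℝ) * Real.sqrt m ≤ u ∧ (u : ℝ) ≤ m + 2 * ((L + 6 : ℕ) : ℝ) * Real.sqrt m), binW (n.choose 2) p u)
    (hlevel : ∀ l ∈ range (n.choose 2 - i + 1),
      ∑ y ∈ slice n (i + l), ∑ x ∈ nbhd i y, |ind f' y - Gref x| ≤
        ((i + l).choose i : ℝ) * ∑ y ∈ slice n (i + l), (|ind f' y - transport j (ind g₀) y| +
          10 * (transport j (ind g₀) y * (1 - transport j (ind g₀) y)))) :
    ∑ x ∈ slice n i, |∑ ρ, padLaw n (padWindow (n.choose 2) m j) ρ * ind f' (fun e => x e || ρ e) - Gref x| ≤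
      #(slice n i) * (2 / cbConst L * ηMC + 10 * (ε / c₀) + 7 / 2 * (20 * (m : ℝ) / (n.choose 2))) := by
  set N := n.choose 2 with hNdef
  set q := Nat.sqrt m with hqdef
  set A := padWindow N m j with hAdef
  set T := transport j (ind g₀) with hTdef
  -- basic sizes
  have hqq : q * q ≤ m := Nat.sqrt_le m
  have hmq : m < (q + 1) * (q + 1) := Nat.lt_succ_sqrt m
  have hq8 : 8 ≤ q := by omega
  have hq1 : 1 ≤ q := by omega
  have hqr : (q : ℝ) ≤ Real.sqrt m :=
    Real.le_sqrt_of_sq_le (by exact_mod_cast (show q ^ 2 ≤ m by nlinarith))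
  have hm0 : (0 : ℝ) ≤ m := Nat.cast_nonneg _
  have hsq0 : 0 ≤ Real.sqrt m := Real.sqrt_nonneg _
  have hW : Real.sqrt m ≤ (q : ℝ) + 1 := by
    rw [Real.sqrt_le_left (by positivity)]
    have : ((m : ℕ) : ℝ) ≤ (((q + 1) ^ 2 : ℕ) : ℝ) := by exact_mod_cast (show m ≤ (q + 1) ^ 2 by nlinarith)
    push_cast at this
    exact this
  have hiN2 : 2 * i ≤ N := by
    -- `i ≤ j + Lq + 1 ≤ 2m` and `16 m ≤ N`
    have h1 : L * q + 1 ≤ m := by nlinarith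
    nlinarith
  have hiN : i ≤ N := by omega
  have hA : A.Nonempty := by
    rw [← card_pos, hAdef, card_padWindow]; omega
  have hwin : ∀ a ∈ A, a ≤ N ∧ (a : ℝ) * i / N / (q : ℝ) ^ 2 ≤ 20 * (m : ℝ) / N ∧
      ∀ h : ℕ, h ≤ a → |(h : ℝ) - (a : ℝ) * i / N| < q → m + q ≤ i + a - h ∧ i + a - h ≤ m + (L + 6) * q := by
    intro a ha
    rw [hAdef, mem_padWindow] at ha
    have h := fun h : ℕ => bridge_window (h := h) hq hqq hmq hjm hji hij hN ha.1 ha.2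
    exact ⟨(h 0).1, (h 0).2.1, fun hh => (h hh).2.2⟩
  have hAN : ∀ a ∈ A, a ≤ N := fun a ha => (hwin a ha).1
  -- the good window and its two constants
  set Good : Finset ℕ := (range (N + 1)).filter (fun s => m + q ≤ s ∧ s ≤ m + (L + 6) * q) with hGood
  have hmemGood : ∀ {s : ℕ}, s ∈ Good ↔ s ≤ N ∧ m + q ≤ s ∧ s ≤ m + (L + 6) * q := by
    intro s; rw [hGood, mem_filter, mem_range, Nat.lt_succ_iff]
  have hGoodN : ∀ s ∈ Good, j ≤ s ∧ (s : ℝ) ≤ m + ((L + 6 : ℕ) : ℝ) * Real.sqrt m := by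
    intro s hs
    rw [hmemGood] at hs
    refine ⟨by omega, ?_⟩
    have h1 : (s : ℝ) ≤ m + (L + 6) * q := by exact_mod_cast hs.2.2
    have h2 : ((L : ℝ) + 6) * q ≤ ((L : ℝ) + 6) * Real.sqrt m := mul_le_mul_of_nonneg_left hqr (by positivity)
    push_cast; linarith
  -- (d) the binomial lower bound on good levels
  have hb : ∀ s ∈ Good, s ≤ N → cbConst L / Real.sqrt m ≤ binW N p s := by
    intro s hs _
    have hs' := hmemGood.1 hs
    have hLsm : (1 : ℝ) ≤ ((L : ℝ) + 6) / 2 := by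
      have : (0 : ℝ) ≤ L := Nat.cast_nonneg _
      linarith
    have h := shellMass_pointwise (b := binW N p) (fun i => binW_def N p i) hp0 hp2 hLsm hmμ hμm hsm (s := s)
      (by
        have : (m : ℝ) ≤ s := by exact_mod_cast (show m ≤ s by omega)
        nlinarith [mul_nonneg (show (0 : ℝ) ≤ ((L : ℝ) + 6) / 2 by positivity) hsq0])
      (by
        have := (hGoodN s hs).2
        push_cast at this
        linarith)
    rw [cbConst]
    calc Real.exp (-(240 * (((L : ℝ) + 6) / 2) ^ 2)) * 3 / 32 / Real.sqrt m
        = Real.exp (-(240 * (((L : ℝ) + 6) / 2) ^ 2)) * 3 / (32 * Real.sqrt m) := by rw [div_div]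
      _ ≤ binW N p s := h
  -- (e) near-Booleanness on good levels
  have hnb : ∀ s ∈ Good, s ≤ N → ∑ y ∈ slice n s, T y * (1 - T y) ≤ #(slice n s) * (ε / c₀) := by
    intro s hs _
    refine nb_bound hp0.le (by linarith) (hGoodN s hs).1 g₀ F hc₀ hF _ (fun u hu => ?_) hU
    rw [mem_filter, mem_range] at hu
    refine ⟨?_, Nat.lt_succ_iff.1 hu.1⟩
    have h1 := (hGoodN s hs).2
    have h2 := hu.2.1
    exact_mod_cast h1.trans h2
  -- (f) the tail of the landing weights
  have hqpos : (0 : ℝ) < q := by exact_mod_cast hq1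
  have htail : ∑ l ∈ (range (n.choose 2 - i + 1)).filter (fun l => i + l ∉ Good), landW n i A l ≤ 20 * (m : ℝ) / N := by
    refine landW_tail_le hiN hA hAN (filter_subset _ _) hqpos (fun a ha l hl h hlh => ?_) (fun a ha => (hwin a ha).2.1)
    rw [mem_filter, mem_range] at hl
    by_contra hdev
    push Not at hdev
    have hha : h ≤ a := by
      have : (0 : ℝ) ≤ l := Nat.cast_nonneg _
      have : (h : ℝ) ≤ a := by linarith
      exact_mod_cast this
    have hgood := (hwin a ha).2.2 h hha hdev
    have hl' : l = a - h := by
      have : (l : ℝ) = ((a - h : ℕ) : ℝ) := by rw [Nat.cast_sub hha]; exact hlh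
      exact_mod_cast this
    apply hl.2
    rw [hmemGood, hl', ← Nat.add_sub_assoc hha]
    exact ⟨by omega, hgood⟩
  -- (h) the slice error
  have hmain := padVote_error (j := j) hp0.le (by linarith) hiN hA hAN f' g₀ Gref hlevel Good
    (bmin := cbConst L / Real.sqrt m) (nbB := ε / c₀) (δt := 20 * (m : ℝ) / N)
    (div_pos (cbConst_pos L) (Real.sqrt_pos.2 (by
      have : (64 : ℝ) ≤ m := by exact_mod_cast (show 64 ≤ m by nlinarith)
      linarith)))
    (div_nonneg ((l1_nonneg hp0.le (by linarith) _ _).trans hF) hc₀.le) hb hnb htail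
  -- (i) the constant `K_A / bmin ≤ 2 / c_b`
  have hKA : (((N : ℝ) + 1) / ((N : ℝ) - i + 1)) / #A / (cbConst L / Real.sqrt m) ≤ 2 / cbConst L := by
    have hcb := cbConst_pos L
    have hi' : 2 * (i : ℝ) ≤ N := by exact_mod_cast hiN2
    have hD : (0 : ℝ) < (N : ℝ) - i + 1 := by linarith [(Nat.cast_nonneg i : (0 : ℝ) ≤ i)]
    have h1 : ((N : ℝ) + 1) / ((N : ℝ) - i + 1) ≤ 2 := by
      rw [div_le_iff₀ hD]; linarith
    have hAcard : (#A : ℝ) = q + 1 := by rw [hAdef, card_padWindow]; push_cast; ring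
    have hsqpos : 0 < Real.sqrt m := by linarith
    rw [hAcard, div_div, div_le_div_iff₀ (by positivity) hcb]
    calc ((N : ℝ) + 1) / ((N : ℝ) - i + 1) * cbConst L ≤ 2 * cbConst L := mul_le_mul_of_nonneg_right h1 hcb.le
      _ = 2 * (cbConst L / Real.sqrt m * Real.sqrt m) := by rw [div_mul_cancel₀ _ hsqpos.ne']
      _ ≤ 2 * (cbConst L / Real.sqrt m * ((q : ℝ) + 1)) := by
          have : 0 ≤ cbConst L / Real.sqrt m := div_nonneg hcb.le hsq0
          nlinarith [mul_le_mul_of_nonneg_left hW this]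
      _ = 2 * (((q : ℝ) + 1) * (cbConst L / Real.sqrt m)) := by ring
  have hl1 : 0 ≤ l1 n p (ind f') T := l1_nonneg hp0.le (by linarith) _ _
  refine hmain.trans (mul_le_mul_of_nonneg_left ?_ (Nat.cast_nonneg _))
  have : (((N : ℝ) + 1) / ((N : ℝ) - i + 1)) / #A / (cbConst L / Real.sqrt m) * l1 n p (ind f') T ≤ 2 / cbConst L * ηMC :=
    calc _ ≤ 2 / cbConst L * l1 n p (ind f') T := mul_le_mul_of_nonneg_right hKA hl1
      _ ≤ 2 / cbConst L * ηMC := mul_le_mul_of_nonneg_left hclose (div_nonneg (by norm_num) (cbConst_pos L).le)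
  linarith


/-! ## Registered form -/

/-- **One slice of the bridge** (registered sub-goal `bridgeSliceError` of stmt-PneNP-18471), written out. [folklore] -/
theorem bridgeSliceError :
  ∀ (n : ℕ) (p : ℝ), 0 < p → p ≤ 1 / 2 → ∀ (m L j i : ℕ),
    (m : ℝ) ≤ ((n.choose 2 : ℕ) : ℝ) * p → ((n.choose 2 : ℕ) : ℝ) * p < m + 1 →
    L + 8 ≤ Nat.sqrt m → 40 * (((L : ℝ) + 6) / 2) ≤ Real.sqrt m → 8 * (L + 2) * m ≤ n.choose 2 → j ≤ m → j ≤ i →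
    i ≤ j + L * Nat.sqrt m + 1 → ∀ (f' g₀ F : (Edge n → Bool) → Bool) (Gref : (Edge n → Bool) → ℝ) (ε ηMC c₀ : ℝ), 0 < c₀ →
    l1 n p (ind F) (transport j (ind g₀)) ≤ ε → l1 n p (ind f') (transport j (ind g₀)) ≤ ηMC →
    c₀ ≤ ∑ u ∈ (range (n.choose 2 + 1)).filter (fun u : ℕ =>
        (m : ℝ) + ((L + 6 : ℕ) : ℝ) * Real.sqrt m ≤ u ∧ (u : ℝ) ≤ m + 2 * ((L + 6 : ℕ) : ℝ) * Real.sqrt m), binW (n.choose 2) p u →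
    (∀ l ∈ range (n.choose 2 - i + 1),
      ∑ y ∈ slice n (i + l), ∑ x ∈ nbhd i y, |ind f' y - Gref x| ≤
        ((i + l).choose i : ℝ) * ∑ y ∈ slice n (i + l), (|ind f' y - transport j (ind g₀) y| +
          10 * (transport j (ind g₀) y * (1 - transport j (ind g₀) y)))) →
    ∑ x ∈ slice n i, |∑ ρ, padLaw n (padWindow (n.choose 2) m j) ρ * ind f' (fun e => x e || ρ e) - Gref x| ≤
      #(slice n i) * (2 / cbConst L * ηMC + 10 * (ε / c₀) + 7 / 2 * (20 * (m : ℝ) / (n.choose 2))) :=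
  fun _ _ hp0 hp2 _ _ _ _ hmμ hμm hq hsm hN hjm hji hij f' g₀ F Gref _ _ _ hc₀ hF hclose hU hlevel =>
    bridge_sliceError hp0 hp2 hmμ hμm hq hsm hN hjm hji hij f' g₀ F Gref hc₀ hF hclose hU hlevel

end

end Summit.PneNP.PneNP.Theorems.MonotoneContinuation
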